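import Literature.Computability.MetaComplexity.KrajicekRamseyReduction
import Literature.Computability.MetaComplexity.FpLinearSystems
import Literature.Computability.MetaComplexity.KEvaluationsOnto
import Literature.Computability.MetaComplexity.TseitinDepthFregeTransfer
import Literature.Computability.MetaComplexity.FregeBoundedTautology

/-!
# PneNP / ExpanderLinearGenerators — the grid routing reduction: definitions

Route `PneNP/ExpanderLinearGenerators`, support for crux stmt-PneNP-11443
(`LinearGeneratorDepthFregeHard`, Krajíček's Problem 19.4.5). Definitions for the Urquhart–Fu /
Ben-Sasson reduction of the BIJECTIVE pigeonhole principle `ontoPHP^{k+2}_{k+1}` to the Tseitin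
system of its ROUTING GRID, which yields an unconditional bounded-depth Frege lower bound for that
family of `4`-sparse linear systems over `𝔽₂` (files `…GridRoutingSystem`, `…SkeletonSteps`,
`…GridRoutingFormulas`, `…GridRoutingChains`, `…GridRoutingClauses`, `…GridRoutingAssembly`,
`…GridRoutingLowerBound`).

The routing grid on `k + 2` pigeons and `k + 1` holes: a pigeon terminal `t_u`, a hole terminal
`h_w`, and a grid point `g(u,w)` for every pair; row `u` is the path
`t_u — g(u,0) — g(u,1) — ⋯ — g(u,k)` (edges `r(u,w)`, entering `g(u,w)` from the left) and column
`w` the path `h_w — g(0,w) — ⋯ — g(k+1,w)` (edges `c(u,w)`, entering `g(u,w)` from above);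
terminals carry charge `1`, grid points `0` (total charge odd: unsolvable). A bijection `f` would
route pigeon `u` along row `u` to `g(u, f u)` and up column `f u` to its hole — the substitution
`r(u,w) ↦ rowOR k u w = ⋁_{w' ≥ w} p_{uw'}`, `c(u,w) ↦ colOR k u w = ⋁_{u' ≥ u} p_{u'w}`.

Contents: index types and numberings (`RowIdx`, `VarIdx`, `rowEquiv`, `varEquiv`), the system
(`edgesOf`, `charge`, `gridSystem`, `rowEdgeEnds`, `colEdgeEnds`); the routing formulas and
substitutions (`rowOR`, `colOR`, `routeOf`, `routeSubst`, `skelOf`, `skelSubst`, `fillSubst`,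
`rowExcl`, `colExcl`, `linkSubst`, `termSkel`, `termFill`); line-count bookkeeping (`stepLines`,
`chainLines`, `maxChainLines`, `clauseLines`, `SR`, `Z₁`, `sizeConst`, `sizePoly`); `ontoPhp`.

References: A. Urquhart, X. Fu, *Simplified lower bounds for propositional proofs*, Notre Dame
J. Formal Logic 37 (1996) 523–544; E. Ben-Sasson, *Hard examples for the bounded depth Frege
proof system*, Comput. Complexity 11 (2002) 109–136, §3; J. Håstad, *On small-depth Frege proofs
for Tseitin for grids*, J. ACM 68 (2020).
-/

namespace Summit.PneNP.PneNP.Theorems.GridRouting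

set_option linter.dupNamespace false -- `Summit.PneNP.PneNP.…`: summit = sub-problem (D-0017)

open Finset Literature.Computability.Complexity Literature.Computability.Complexity.PropForm
open Literature.Computability.MetaComplexity Literature.Computability.MetaComplexity.TextbookFrege
open Literature.Computability.MetaComplexity.KrajicekRamsey (clauseOf)

/-! ### The grid routing system -/

/-- Row indices of the grid routing system on `k + 2` pigeons and `k + 1` holes: a pigeon
terminal, a hole terminal, or a grid point `(pigeon, hole)`. -/
abbrev RowIdx (k : ℕ) : Type := Fin (k + 2) ⊕ (Fin (k + 1) ⊕ (Fin (k + 2) × Fin (k + 1)))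

/-- Edge (variable) indices: a row edge `r(u, w)` (entering `g(u,w)` from the left; `r(u,0)`
starts at the pigeon terminal `t_u`) or a column edge `c(u, w)` (entering `g(u,w)` from above;
`c(0,w)` starts at the hole terminal `h_w`). -/
abbrev VarIdx (k : ℕ) : Type := (Fin (k + 2) × Fin (k + 1)) ⊕ (Fin (k + 2) × Fin (k + 1))

/-- Number of equations. -/
abbrev nRows (k : ℕ) : ℕ := (k + 2) + ((k + 1) + (k + 2) * (k + 1))

/-- Number of variables. -/
abbrev nVars (k : ℕ) : ℕ := (k + 2) * (k + 1) + (k + 2) * (k + 1)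

/-- The numbering of the rows. -/
def rowEquiv (k : ℕ) : RowIdx k ≃ Fin (nRows k) :=
  (Equiv.sumCongr (Equiv.refl _) ((Equiv.sumCongr (Equiv.refl _) finProdFinEquiv).trans
    finSumFinEquiv)).trans finSumFinEquiv

/-- The numbering of the variables: `r(u,w) ↦ w + (k+1) u`, `c(u,w) ↦ (k+2)(k+1) + w + (k+1) u`. -/
def varEquiv (k : ℕ) : VarIdx k ≃ Fin (nVars k) :=
  (Equiv.sumCongr finProdFinEquiv finProdFinEquiv).trans finSumFinEquiv

/-- The edges of an equation: `t_u : {r(u,0)}`, `h_w : {c(0,w)}`,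
`g(u,w) : {r(u,w), c(u,w)} ∪ {r(u,w+1) if w < k} ∪ {c(u+1,w) if u ≤ k}`. -/
def edgesOf (k : ℕ) : RowIdx k → Finset (VarIdx k)
  | Sum.inl u => {Sum.inl (u, 0)}
  | Sum.inr (Sum.inl w) => {Sum.inr (0, w)}
  | Sum.inr (Sum.inr (u, w)) =>
      ({Sum.inl (u, w), Sum.inr (u, w)} ∪
        (if h : (w : ℕ) + 1 < k + 1 then {Sum.inl (u, ⟨w + 1, h⟩)} else ∅)) ∪
        (if h : (u : ℕ) + 1 < k + 2 then {Sum.inr (⟨u + 1, h⟩, w)} else ∅)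

/-- The charge of an equation: `1` at the terminals, `0` at the grid points. -/
def charge (k : ℕ) : RowIdx k → ZMod 2
  | Sum.inl _ => 1
  | Sum.inr (Sum.inl _) => 1
  | Sum.inr (Sum.inr _) => 0

/-- **The grid routing system** over `𝔽₂`: equation `r` says that the sum of the values of the
edges of `r` is its charge. -/
def gridSystem (k : ℕ) : Fin (nRows k) → LinEqMod 2 (nVars k) := fun i =>
  (fun j => if (varEquiv k).symm j ∈ edgesOf k ((rowEquiv k).symm i) then 1 else 0,
    charge k ((rowEquiv k).symm i))

/-- The two equations of a row edge `r(u,w)`: the grid point `g(u,w)`, and the pigeon terminal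
`t_u` (`w = 0`) or the grid point `g(u,w-1)`. -/
def rowEdgeEnds (k : ℕ) (u : Fin (k + 2)) (w : Fin (k + 1)) : Finset (RowIdx k) :=
  {Sum.inr (Sum.inr (u, w)),
    if (w : ℕ) = 0 then Sum.inl u else Sum.inr (Sum.inr (u, ⟨(w : ℕ) - 1, by omega⟩))}

/-- The two equations of a column edge `c(u,w)`: the grid point `g(u,w)`, and the hole terminal
`h_w` (`u = 0`) or the grid point `g(u-1,w)`. -/
def colEdgeEnds (k : ℕ) (u : Fin (k + 2)) (w : Fin (k + 1)) : Finset (RowIdx k) :=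
  {Sum.inr (Sum.inr (u, w)),
    if (u : ℕ) = 0 then Sum.inr (Sum.inl w) else Sum.inr (Sum.inr (⟨(u : ℕ) - 1, by omega⟩, w))}

/-! ### The routing formulas, substitutions and skeletons -/

/-- `rowOR k u w = ⋁_{w' ∈ [w, k+1)} p_{u w'}`: the row edge `r(u,w)` is used by the routing of a
bijection `f` iff `f u ≥ w` (pigeon `u` travels along its row up to the column `f u`). -/
def rowOR (k : ℕ) (u w : ℕ) : PropForm ℕ :=
  clauseOf ((List.range' w (k + 1 - w)).map fun w' => (u * (k + 1) + w', true))

/-- `colOR k u w = ⋁_{u' ∈ [u, k+2)} p_{u' w}`: the column edge `c(u,w)` is used iff the pigeon of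
hole `w` is `≥ u` (it travels up column `w` from its grid point to the hole terminal). -/
def colOR (k : ℕ) (u w : ℕ) : PropForm ℕ :=
  clauseOf ((List.range' u (k + 2 - u)).map fun u' => (u' * (k + 1) + w, true))

/-- The routing formula of an edge. -/
def routeOf (k : ℕ) : VarIdx k → PropForm ℕ
  | Sum.inl (u, w) => rowOR k u w
  | Sum.inr (u, w) => colOR k u w

/-- **The routing substitution** on the variables of the grid system: `r(u,w) ↦ rowOR k u w`,
`c(u,w) ↦ colOR k u w` (anything else `↦ ⊥`). -/
def routeSubst (k : ℕ) (x : ℕ) : PropForm ℕ :=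
  if h : x < nVars k then routeOf k ((varEquiv k).symm ⟨x, h⟩) else const false

/-- The skeleton of the four edges at the grid point `g(u,w)` over the schematic variables
`x₀ = p_{uw}`, `x₁ = rowOR k u (w+1)`, `x₂ = colOR k (u+1) w`: `r(u,w) ↦ x₀ ∨ x₁`,
`r(u,w+1) ↦ x₁`, `c(u,w) ↦ x₀ ∨ x₂`, `c(u+1,w) ↦ x₂`, a missing second edge contributing `⊥`. -/
def skelOf (k : ℕ) (u : Fin (k + 2)) (w : Fin (k + 1)) : VarIdx k → PropForm ℕ
  | Sum.inl (u', w') =>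
      if u' = u ∧ w' = w then disj (var 0) (if (w : ℕ) + 1 < k + 1 then var 1 else const false)
      else if u' = u ∧ (w' : ℕ) = w + 1 then var 1 else const false
  | Sum.inr (u', w') =>
      if u' = u ∧ w' = w then disj (var 0) (if (u : ℕ) + 1 < k + 2 then var 2 else const false)
      else if w' = w ∧ (u' : ℕ) = u + 1 then var 2 else const false

/-- The skeleton substitution at `g(u,w)` on the variables of the grid system. -/
def skelSubst (k : ℕ) (u : Fin (k + 2)) (w : Fin (k + 1)) (x : ℕ) : PropForm ℕ :=
  if h : x < nVars k then skelOf k u w ((varEquiv k).symm ⟨x, h⟩) else const false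

/-- The filling of the skeleton at `g(u,w)`: `x₀ ↦ p_{uw}`, `x₁ ↦ rowOR k u (w+1)`,
`x₂ ↦ colOR k (u+1) w`. -/
def fillSubst (k : ℕ) (u : Fin (k + 2)) (w : Fin (k + 1)) (y : ℕ) : PropForm ℕ :=
  if y = 0 then var ((u : ℕ) * (k + 1) + w)
  else if y = 1 then rowOR k u (w + 1)
  else if y = 2 then colOR k (u + 1) w
  else const false

/-- `rowExcl k u w v = ¬p_{uw} ∨ ¬rowOR k u v`: pigeon `u` does not sit in hole `w` and at the
same time travel on to a hole `≥ v` (for `w < v`: functionality). -/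
def rowExcl (k : ℕ) (u w v : ℕ) : PropForm ℕ :=
  disj (neg (var (u * (k + 1) + w))) (neg (rowOR k u v))

/-- `colExcl k u w v = ¬p_{uw} ∨ ¬colOR k v w`: hole `w` does not receive pigeon `u` and at the
same time a pigeon `≥ v` (for `u < v`: injectivity). -/
def colExcl (k : ℕ) (u w v : ℕ) : PropForm ℕ :=
  disj (neg (var (u * (k + 1) + w))) (neg (colOR k v w))

/-- The schematic substitution of a chain link: `x₀ ↦ p`, `x₁ ↦ q`, `x₂ ↦ Y`. -/
def linkSubst (p q : ℕ) (Y : PropForm ℕ) (y : ℕ) : PropForm ℕ :=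
  if y = 0 then var p else if y = 1 then var q else if y = 2 then Y else const false

/-- The schematic substitution at a terminal: the terminal edge `a ↦ x₀`. -/
def termSkel (a : ℕ) (x : ℕ) : PropForm ℕ := if x = a then var 0 else const false

/-- The filling at a terminal: `x₀ ↦ Y`. -/
def termFill (Y : PropForm ℕ) (y : ℕ) : PropForm ℕ := if y = 0 then Y else const false

/-! ### The pigeonhole side and the bookkeeping constants -/

/-- The rendered bijective pigeonhole CNF `⋀ ontoPHP^{n+1}_n`. -/
abbrev ontoPhp (n : ℕ) : PropForm ℕ := PropForm.ofCNF (ontoPigeonholeCNF (n + 1) n)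

/-- Line count of a skeleton step with hypothesis derivations of `m₁`, `m₂` lines. -/
def stepLines (m₁ m₂ : ℕ) : ℕ :=
  tautLines 3 64 + m₁ + m₂ + 6000

/-- Line count of an exclusion chain of `t` links. -/
def chainLines (k : ℕ) : ℕ → ℕ
  | 0 => 5
  | t + 1 => stepLines (1400 * (k + 1 + 2) ^ 4) (chainLines k t)

/-- Line count of the chains used at any grid point. -/
def maxChainLines (k : ℕ) : ℕ := chainLines k (k + 1)

/-- Line count of a clause derivation. -/
def clauseLines (k : ℕ) : ℕ := stepLines (maxChainLines k) (maxChainLines k)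

/-- The size bound of the pigeonhole side, `SR = 8 (k+3)⁴ + 1`. -/
abbrev SR (k : ℕ) : ℕ := 8 * (k + 3) ^ 4 + 1

/-- The size bound of the substituted formulas, `Z₁ = 2 (k+2) + 1`. -/
abbrev Z₁ (k : ℕ) : ℕ := 2 * (k + 2) + 1

/-- The constant of the polynomial size bound of the reduction (`T₀ = tautLines 3 64`, the
truth-table cost of a skeleton). -/
def sizeConst : ℕ := 3016 * (3 * tautLines 3 64 + 24000)

/-- The polynomial bounding the size of the reduction: `sizePoly k = C (k+3)⁹`. -/
def sizePoly (k : ℕ) : ℕ := sizeConst * (k + 3) ^ 9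

end Summit.PneNP.PneNP.Theorems.GridRouting
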